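import Literature.MathematicalPhysics.QuantumLattice.DWaveSourceTorusJointPressure
import Literature.MathematicalPhysics.QuantumLattice.DWaveSourceLeeYang
import HarnessLib

/-!
# Evenness in the source: the interaction correction to the pair response of the pressure is `O(|U| h²)`

Topic `MathematicalPhysics/QuantumLattice`; sharpening of
`DWaveSourceTorusJointPressure.dWaveSourceTorus_log_partitionFn_jointExpansion` by the evenness of the
sourced partition function in the source (gauge rotation,
`DWaveSourceLeeYang.partitionFn_hubbardTorusWith_sub_neg_smul_pairSource`). In the joint expansion
`log Re Z_L(U,h) = βμL² + log Re Z₀ + Re Σ_j Σ_m C_{j,m} U^{j-m} h^m` the part that is ODD in `h` vanishes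
identically; comparing orders in `h` (the coefficient of `h¹` is recovered as a limit, no analytic
continuation is used) shows that the `h`-LINEAR terms `Re Σ_{j} C_{j,1} U^{j-1}` vanish for every small `U`,
hence the mixed `(U,h)`-increment of `log Z_L` starts at order `U h²`:

`|log Z_L(U,h) - log Z_L(U,0) - log Z_L(0,h) + log Z_L(0,0)| ≤ K L² |U| h²`

for `|U|, |h| ≤ δ`, uniformly in `L ≥ 3` (`dWaveSourceTorus_log_partitionFn_mixed_increment_le_sq`): at fixed
temperature the interaction changes the PAIR SUSCEPTIBILITY of the finite-volume pressure (the `h²`-response) by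
`O(|U|)`, uniformly in the volume — the single-scale form of hypothesis `(A_χ)` of the route ThermalWedge's engine
(there required on `β ≤ e^{a/U}` with `(1 + log β)` growth). Everything is PROVED; no definition and no named fact.

## References
* G. Benfatto, A. Giuliani, V. Mastropietro, Ann. Henri Poincaré 7 (2006) 809–898, §2, (2.77).
  [cite: BenfattoGiulianiMastropietro2006, (2.77)]
* T. Koma, H. Tasaki, J. Stat. Phys. 76 (1994) 745–803, §1. [cite: KomaTasaki1994, §1]
-/

noncomputable section

open scoped Matrix.Norms.L2Operator ComplexOrder
open Finset MeasureTheory Filter Topology NormedSpace Set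
open Literature.Probability.LatticeModels

namespace Literature.MathematicalPhysics.QuantumLattice

-- the generic `DecidableEq` path on `Orb (FermionTorus 2 L)` (cf. `ShibaFreeThermalKernel`)
attribute [-instance] instDecidableEqLex

/-! ### Elementary estimates on the monomials -/

section Monomials

/-- A real number bounded by `C t²` for all small `t > 0` vanishes. [folklore] -/
theorem eq_zero_of_abs_le_mul_sq {b C δ : ℝ} (hδ : 0 < δ) (hC : 0 ≤ C)
    (h : ∀ t : ℝ, 0 < t → t ≤ δ → |b| ≤ C * t ^ 2) : b = 0 := by
  by_contra hb
  have hb0 : 0 < |b| := abs_pos.mpr hb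
  set t : ℝ := min δ (|b| / (2 * (C + 1) * δ)) with ht
  have htpos : 0 < t := lt_min hδ (by positivity)
  have htδ : t ≤ δ := min_le_left _ _
  have ht2 : t ≤ |b| / (2 * (C + 1) * δ) := min_le_right _ _
  have key := h t htpos htδ
  have h1 : C * t ^ 2 ≤ C * (t * δ) := by
    rw [sq]; exact mul_le_mul_of_nonneg_left (mul_le_mul_of_nonneg_left htδ htpos.le) hC
  have h2 : C * (t * δ) ≤ C * (|b| / (2 * (C + 1) * δ) * δ) :=
    mul_le_mul_of_nonneg_left (mul_le_mul_of_nonneg_right ht2 hδ.le) hC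
  have h3 : C * (|b| / (2 * (C + 1) * δ) * δ) = |b| * (C / (2 * (C + 1))) := by
    field_simp
  have h4 : C / (2 * (C + 1)) < 1 := by
    rw [div_lt_one (by positivity)]; linarith
  have : |b| < |b| := by
    calc |b| ≤ C * t ^ 2 := key
      _ ≤ |b| * (C / (2 * (C + 1))) := by linarith [h1, h2, h3.le]
      _ < |b| * 1 := mul_lt_mul_of_pos_left h4 hb0
      _ = |b| := mul_one _
  exact lt_irrefl _ this

variable {U h δ : ℝ}

/-- **Odd part of the monomials, beyond the linear term**: for `1 ≤ j`, `m ≤ j`, `|U|, |h| ≤ δ`,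
`‖U^{j-m}(h^m - (-h)^m) - [m = 1] 2U^{j-1}h‖ ≤ [3 ≤ m] 2|h|³ δ^{j-3}`. [folklore] -/
theorem norm_odd_monomial_le (hU : |U| ≤ δ) (hh : |h| ≤ δ) {j m : ℕ} (hj : 1 ≤ j) (hm : m ≤ j) :
    ‖(U : ℂ) ^ (j - m) * ((h : ℂ) ^ m - (-(h : ℂ)) ^ m) -
        (if m = 1 then 2 * (U : ℂ) ^ (j - 1) * (h : ℂ) else 0)‖ ≤
      if 3 ≤ m then 2 * |h| ^ 3 * δ ^ (j - 3) else 0 := by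
  have hδ0 : 0 ≤ δ := (abs_nonneg U).trans hU
  rcases Nat.lt_or_ge m 3 with hm3 | hm3
  · interval_cases m
    · simp
    · rw [if_pos rfl, if_neg (by norm_num : ¬ (3 ≤ 1)), pow_one, pow_one,
        show (U : ℂ) ^ (j - 1) * ((h : ℂ) - -(h : ℂ)) - 2 * (U : ℂ) ^ (j - 1) * (h : ℂ) = 0 by ring, norm_zero]
    · rw [if_neg (by norm_num : ¬ ((2 : ℕ) = 1)), if_neg (by norm_num : ¬ (3 ≤ 2)), neg_sq, sub_self,
        mul_zero, sub_zero, norm_zero]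
  · rw [if_pos hm3, if_neg (show ¬ (m = 1) by omega), sub_zero, norm_mul, norm_pow, Complex.norm_real,
      Real.norm_eq_abs]
    have hdiff : ‖(h : ℂ) ^ m - (-(h : ℂ)) ^ m‖ ≤ 2 * |h| ^ m := by
      calc ‖(h : ℂ) ^ m - (-(h : ℂ)) ^ m‖ ≤ ‖(h : ℂ) ^ m‖ + ‖(-(h : ℂ)) ^ m‖ := norm_sub_le _ _
        _ = 2 * |h| ^ m := by rw [norm_pow, norm_pow, norm_neg, Complex.norm_real, Real.norm_eq_abs]; ring
    have hUp : |U| ^ (j - m) ≤ δ ^ (j - m) := pow_le_pow_left₀ (abs_nonneg _) hU _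
    have hhp : |h| ^ m ≤ |h| ^ 3 * δ ^ (m - 3) := by
      have e : m = 3 + (m - 3) := by omega
      conv_lhs => rw [e, pow_add]
      exact mul_le_mul_of_nonneg_left (pow_le_pow_left₀ (abs_nonneg _) hh _) (by positivity)
    have hexp : δ ^ (j - m) * δ ^ (m - 3) = δ ^ (j - 3) := by rw [← pow_add]; congr 1; omega
    calc |U| ^ (j - m) * ‖(h : ℂ) ^ m - (-(h : ℂ)) ^ m‖ ≤ δ ^ (j - m) * (2 * (|h| ^ 3 * δ ^ (m - 3))) :=
          mul_le_mul hUp (hdiff.trans (by linarith [hhp])) (norm_nonneg _) (by positivity)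
      _ = 2 * |h| ^ 3 * (δ ^ (j - m) * δ ^ (m - 3)) := by ring
      _ = 2 * |h| ^ 3 * δ ^ (j - 3) := by rw [hexp]

/-- **Mixed increments of the monomials, beyond the `h`-linear term**: for `1 ≤ j`, `m ≤ j`, `|U|, |h| ≤ δ`,
`‖D_m - [m = 1 ∧ 2 ≤ j] U^{j-1}h‖ ≤ [2 ≤ m ≤ j-1] |U| h² δ^{j-3}`,
`D_m = U^{j-m}h^m - U^{j-m}0^m - 0^{j-m}h^m + 0^{j-m}0^m`. [folklore] -/
theorem norm_mixed_monomial_sub_linear_le (hU : |U| ≤ δ) (hh : |h| ≤ δ) {j m : ℕ} (hj : 1 ≤ j) (hm : m ≤ j) :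
    ‖((U : ℂ) ^ (j - m) * (h : ℂ) ^ m - (U : ℂ) ^ (j - m) * (0 : ℂ) ^ m -
        (0 : ℂ) ^ (j - m) * (h : ℂ) ^ m + (0 : ℂ) ^ (j - m) * (0 : ℂ) ^ m) -
        (if m = 1 ∧ 2 ≤ j then (U : ℂ) ^ (j - 1) * (h : ℂ) else 0)‖ ≤
      if 2 ≤ m ∧ m + 1 ≤ j then |U| * h ^ 2 * δ ^ (j - 3) else 0 := by
  have hδ0 : 0 ≤ δ := (abs_nonneg U).trans hU
  rcases Nat.eq_zero_or_pos m with rfl | hm0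
  · -- `m = 0`
    have hj0 : j - 0 ≠ 0 := by omega
    rw [if_neg (show ¬ ((0 : ℕ) = 1 ∧ 2 ≤ j) by omega), if_neg (show ¬ (2 ≤ (0 : ℕ) ∧ 0 + 1 ≤ j) by omega)]
    simp only [pow_zero, mul_one, zero_pow hj0, sub_self, zero_add, norm_zero, le_refl]
  rcases eq_or_lt_of_le hm with rfl | hmj
  · -- `m = j`
    have hm0' : m ≠ 0 := by omega
    rw [if_neg (show ¬ (m = 1 ∧ 2 ≤ m) by omega), if_neg (show ¬ (2 ≤ m ∧ m + 1 ≤ m) by omega)]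
    simp only [Nat.sub_self, pow_zero, one_mul, zero_pow hm0', mul_zero, sub_zero, sub_self, zero_add,
      norm_zero, le_refl]
  · have hm0' : m ≠ 0 := by omega
    have hjm : j - m ≠ 0 := by omega
    by_cases h1 : m = 1
    · -- the linear term
      subst h1
      rw [if_pos ⟨rfl, by omega⟩, if_neg (show ¬ (2 ≤ 1 ∧ 1 + 1 ≤ j) by omega)]
      simp only [pow_one, zero_pow hjm, mul_zero, zero_mul, sub_zero, add_zero, sub_self, norm_zero, le_refl]
    · rw [if_neg (show ¬ (m = 1 ∧ 2 ≤ j) from fun h' => h1 h'.1),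
        if_pos (show 2 ≤ m ∧ m + 1 ≤ j from ⟨by omega, by omega⟩), sub_zero]
      simp only [zero_pow hm0', zero_pow hjm, mul_zero, zero_mul, sub_zero, add_zero, norm_mul, norm_pow,
        Complex.norm_real, Real.norm_eq_abs]
      have hpU : |U| ^ (j - m) = |U| ^ (j - m - 1) * |U| := by rw [← pow_succ]; congr 1; omega
      have hph : |h| ^ m = |h| ^ (m - 2) * |h| ^ 2 := by rw [← pow_add]; congr 1; omega
      have hpδ : δ ^ (j - 3) = δ ^ (j - m - 1) * δ ^ (m - 2) := by rw [← pow_add]; congr 1; omega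
      rw [hpU, hph, hpδ, ← sq_abs h]
      have hUp : |U| ^ (j - m - 1) ≤ δ ^ (j - m - 1) := pow_le_pow_left₀ (abs_nonneg _) hU _
      have hhp : |h| ^ (m - 2) ≤ δ ^ (m - 2) := pow_le_pow_left₀ (abs_nonneg _) hh _
      calc |U| ^ (j - m - 1) * |U| * (|h| ^ (m - 2) * |h| ^ 2)
          = (|U| * |h| ^ 2) * (|U| ^ (j - m - 1) * |h| ^ (m - 2)) := by ring
        _ ≤ (|U| * |h| ^ 2) * (δ ^ (j - m - 1) * δ ^ (m - 2)) :=
            mul_le_mul_of_nonneg_left (mul_le_mul hUp hhp (by positivity) (by positivity)) (by positivity)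
        _ = |U| * |h| ^ 2 * (δ ^ (j - m - 1) * δ ^ (m - 2)) := by ring

variable {Cf : ℕ → ℕ → ℂ} {B ϱ : ℝ}

/-- The radius arithmetic `ϱ^j δ^{j-3} ≤ 27 ϱ³ 3^{-j}` for `j ≥ 3`, `ϱδ ≤ 1/3`. [folklore] -/
theorem pow_mul_pow_sub_three_le (hϱ : 0 ≤ ϱ) (hδ : 0 ≤ δ) (hϱδ : ϱ * δ ≤ 1 / 3) {j : ℕ} (hj : 3 ≤ j) :
    ϱ ^ j * δ ^ (j - 3) ≤ 27 * ϱ ^ 3 * (1 / 3) ^ j := by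
  have e1 : ϱ ^ j = ϱ ^ 3 * ϱ ^ (j - 3) := by rw [← pow_add]; congr 1; omega
  have e2 : (1 / 3 : ℝ) ^ (j - 3) = 27 * (1 / 3) ^ j := by
    have : j = (j - 3) + 3 := by omega
    conv_rhs => rw [this, pow_add]
    norm_num
    ring
  calc ϱ ^ j * δ ^ (j - 3) = ϱ ^ 3 * (ϱ * δ) ^ (j - 3) := by rw [e1, mul_pow]; ring
    _ ≤ ϱ ^ 3 * (1 / 3) ^ (j - 3) :=
        mul_le_mul_of_nonneg_left (pow_le_pow_left₀ (by positivity) hϱδ _) (by positivity)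
    _ = 27 * ϱ ^ 3 * (1 / 3) ^ j := by rw [e2]; ring

/-- **The odd part of the order-`j` polynomial beyond its linear term is `O(h³)`**: with
`‖C_{j,m}‖ ≤ B ϱ^j`, `ϱδ ≤ 1/3`, `|U|, |h| ≤ δ`, `j ≥ 1`:
`‖P_j(U,h) - P_j(U,-h) - 2 C_{j,1} U^{j-1} h‖ ≤ 54 B ϱ³ (j+1) 3^{-j} |h|³`. [folklore] -/
theorem norm_odd_part_sub_linear_le (hB : 0 ≤ B) (hϱ : 0 ≤ ϱ) (hδ : 0 < δ) (hϱδ : ϱ * δ ≤ 1 / 3)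
    (hCfb : ∀ j m : ℕ, 1 ≤ j → ‖Cf j m‖ ≤ B * ϱ ^ j) (hU : |U| ≤ δ) (hh : |h| ≤ δ) {j : ℕ} (hj : 1 ≤ j) :
    ‖(∑ m ∈ Finset.range (j + 1), Cf j m * (U : ℂ) ^ (j - m) * (h : ℂ) ^ m) -
        (∑ m ∈ Finset.range (j + 1), Cf j m * (U : ℂ) ^ (j - m) * (((-h : ℝ)) : ℂ) ^ m) -
        2 * Cf j 1 * (U : ℂ) ^ (j - 1) * (h : ℂ)‖ ≤
      54 * B * ϱ ^ 3 * (((j : ℝ) + 1) * (1 / 3) ^ j) * |h| ^ 3 := by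
  have h1mem : 1 ∈ Finset.range (j + 1) := Finset.mem_range.mpr (by omega)
  -- rewrite as one sum of `C_{j,m} · (odd monomial minus linear term)`
  have hlin : 2 * Cf j 1 * (U : ℂ) ^ (j - 1) * (h : ℂ) = ∑ m ∈ Finset.range (j + 1),
      Cf j m * (if m = 1 then 2 * (U : ℂ) ^ (j - 1) * (h : ℂ) else 0) := by
    rw [Finset.sum_congr rfl fun m _ => (mul_ite (m = 1) (Cf j m) _ _)]
    simp only [mul_zero]
    rw [Finset.sum_ite_eq', if_pos h1mem]
    ring
  have hcomb : (∑ m ∈ Finset.range (j + 1), Cf j m * (U : ℂ) ^ (j - m) * (h : ℂ) ^ m) -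
      (∑ m ∈ Finset.range (j + 1), Cf j m * (U : ℂ) ^ (j - m) * (((-h : ℝ)) : ℂ) ^ m) -
      2 * Cf j 1 * (U : ℂ) ^ (j - 1) * (h : ℂ) =
      ∑ m ∈ Finset.range (j + 1), Cf j m * ((U : ℂ) ^ (j - m) * ((h : ℂ) ^ m - (-(h : ℂ)) ^ m) -
        (if m = 1 then 2 * (U : ℂ) ^ (j - 1) * (h : ℂ) else 0)) := by
    rw [hlin, ← Finset.sum_sub_distrib, ← Finset.sum_sub_distrib]
    refine Finset.sum_congr rfl fun m _ => ?_
    push_cast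
    ring
  rw [hcomb]
  refine (norm_sum_le _ _).trans ?_
  have hterm : ∀ m ∈ Finset.range (j + 1), ‖Cf j m * ((U : ℂ) ^ (j - m) * ((h : ℂ) ^ m - (-(h : ℂ)) ^ m) -
      (if m = 1 then 2 * (U : ℂ) ^ (j - 1) * (h : ℂ) else 0))‖ ≤
      B * ϱ ^ j * (if 3 ≤ j then 2 * |h| ^ 3 * δ ^ (j - 3) else 0) := by
    intro m hm
    have hmj : m ≤ j := Nat.lt_succ_iff.mp (Finset.mem_range.mp hm)
    rw [norm_mul]
    refine mul_le_mul (hCfb j m hj) ((norm_odd_monomial_le hU hh hj hmj).trans ?_) (norm_nonneg _)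
      (by positivity)
    split_ifs with h3m h3j <;> first | exact le_rfl | (exfalso; omega) | positivity
  refine (Finset.sum_le_sum hterm).trans ?_
  rw [Finset.sum_const, Finset.card_range, nsmul_eq_mul]
  split_ifs with h3j
  · have hpow := pow_mul_pow_sub_three_le hϱ hδ.le hϱδ h3j
    calc ((j + 1 : ℕ) : ℝ) * (B * ϱ ^ j * (2 * |h| ^ 3 * δ ^ (j - 3)))
        = 2 * B * |h| ^ 3 * ((j : ℝ) + 1) * (ϱ ^ j * δ ^ (j - 3)) := by push_cast; ring
      _ ≤ 2 * B * |h| ^ 3 * ((j : ℝ) + 1) * (27 * ϱ ^ 3 * (1 / 3) ^ j) :=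
          mul_le_mul_of_nonneg_left hpow (by positivity)
      _ = 54 * B * ϱ ^ 3 * (((j : ℝ) + 1) * (1 / 3) ^ j) * |h| ^ 3 := by ring
  · rw [mul_zero, mul_zero]; positivity

/-- **The mixed increment of the order-`j` polynomial beyond its `h`-linear term is `O(|U| h²)`**:
`‖Σ_m C_{j,m} D_m - [2 ≤ j] C_{j,1} U^{j-1} h‖ ≤ 27 B ϱ³ (j+1) 3^{-j} |U| h²`. [folklore] -/
theorem norm_mixed_part_sub_linear_le (hB : 0 ≤ B) (hϱ : 0 ≤ ϱ) (hδ : 0 < δ) (hϱδ : ϱ * δ ≤ 1 / 3)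
    (hCfb : ∀ j m : ℕ, 1 ≤ j → ‖Cf j m‖ ≤ B * ϱ ^ j) (hU : |U| ≤ δ) (hh : |h| ≤ δ) {j : ℕ} (hj : 1 ≤ j) :
    ‖(∑ m ∈ Finset.range (j + 1), Cf j m *
        ((U : ℂ) ^ (j - m) * (h : ℂ) ^ m - (U : ℂ) ^ (j - m) * (0 : ℂ) ^ m -
          (0 : ℂ) ^ (j - m) * (h : ℂ) ^ m + (0 : ℂ) ^ (j - m) * (0 : ℂ) ^ m)) -
        (if 2 ≤ j then Cf j 1 * (U : ℂ) ^ (j - 1) * (h : ℂ) else 0)‖ ≤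
      27 * B * ϱ ^ 3 * (((j : ℝ) + 1) * (1 / 3) ^ j) * |U| * h ^ 2 := by
  have h1mem : 1 ∈ Finset.range (j + 1) := Finset.mem_range.mpr (by omega)
  have hlin : (if 2 ≤ j then Cf j 1 * (U : ℂ) ^ (j - 1) * (h : ℂ) else 0) = ∑ m ∈ Finset.range (j + 1),
      Cf j m * (if m = 1 ∧ 2 ≤ j then (U : ℂ) ^ (j - 1) * (h : ℂ) else 0) := by
    by_cases h2 : 2 ≤ j
    · simp only [h2, and_true, if_true]
      rw [Finset.sum_congr rfl fun m _ => (mul_ite (m = 1) (Cf j m) _ _)]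
      simp only [mul_zero]
      rw [Finset.sum_ite_eq', if_pos h1mem]
      ring
    · simp only [h2, and_false, if_false, mul_zero, Finset.sum_const_zero]
  have hcomb : (∑ m ∈ Finset.range (j + 1), Cf j m *
        ((U : ℂ) ^ (j - m) * (h : ℂ) ^ m - (U : ℂ) ^ (j - m) * (0 : ℂ) ^ m -
          (0 : ℂ) ^ (j - m) * (h : ℂ) ^ m + (0 : ℂ) ^ (j - m) * (0 : ℂ) ^ m)) -
        (if 2 ≤ j then Cf j 1 * (U : ℂ) ^ (j - 1) * (h : ℂ) else 0) =
      ∑ m ∈ Finset.range (j + 1), Cf j m *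
        (((U : ℂ) ^ (j - m) * (h : ℂ) ^ m - (U : ℂ) ^ (j - m) * (0 : ℂ) ^ m -
          (0 : ℂ) ^ (j - m) * (h : ℂ) ^ m + (0 : ℂ) ^ (j - m) * (0 : ℂ) ^ m) -
          (if m = 1 ∧ 2 ≤ j then (U : ℂ) ^ (j - 1) * (h : ℂ) else 0)) := by
    rw [hlin, ← Finset.sum_sub_distrib]
    refine Finset.sum_congr rfl fun m _ => ?_
    ring
  rw [hcomb]
  refine (norm_sum_le _ _).trans ?_
  have hterm : ∀ m ∈ Finset.range (j + 1), ‖Cf j m *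
      (((U : ℂ) ^ (j - m) * (h : ℂ) ^ m - (U : ℂ) ^ (j - m) * (0 : ℂ) ^ m -
        (0 : ℂ) ^ (j - m) * (h : ℂ) ^ m + (0 : ℂ) ^ (j - m) * (0 : ℂ) ^ m) -
        (if m = 1 ∧ 2 ≤ j then (U : ℂ) ^ (j - 1) * (h : ℂ) else 0))‖ ≤
      B * ϱ ^ j * (if 3 ≤ j then |U| * h ^ 2 * δ ^ (j - 3) else 0) := by
    intro m hm
    have hmj : m ≤ j := Nat.lt_succ_iff.mp (Finset.mem_range.mp hm)
    rw [norm_mul]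
    refine mul_le_mul (hCfb j m hj) ((norm_mixed_monomial_sub_linear_le hU hh hj hmj).trans ?_)
      (norm_nonneg _) (by positivity)
    split_ifs with h2m h3j <;> first | exact le_rfl | (exfalso; omega) | positivity
  refine (Finset.sum_le_sum hterm).trans ?_
  rw [Finset.sum_const, Finset.card_range, nsmul_eq_mul]
  split_ifs with h3j
  · have hpow := pow_mul_pow_sub_three_le hϱ hδ.le hϱδ h3j
    calc ((j + 1 : ℕ) : ℝ) * (B * ϱ ^ j * (|U| * h ^ 2 * δ ^ (j - 3)))
        = B * |U| * h ^ 2 * ((j : ℝ) + 1) * (ϱ ^ j * δ ^ (j - 3)) := by push_cast; ring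
      _ ≤ B * |U| * h ^ 2 * ((j : ℝ) + 1) * (27 * ϱ ^ 3 * (1 / 3) ^ j) :=
          mul_le_mul_of_nonneg_left hpow (by positivity)
      _ = 27 * B * ϱ ^ 3 * (((j : ℝ) + 1) * (1 / 3) ^ j) * |U| * h ^ 2 := by ring
  · rw [mul_zero, mul_zero]; positivity

end Monomials

/-! ### The theorem -/

section Pressure

variable (β μ : ℝ)

/-- **Evenness in the source**: `Z_L(β; U, μ, -h) = Z_L(β; U, μ, h)` (gauge rotation by `π/2`,
`partitionFn_hubbardTorusWith_sub_neg_smul_pairSource`). [cite: KomaTasaki1994, §1] -/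
theorem partitionFn_dWaveSourceTorus_neg_source {L : ℕ} [NeZero L] (U h : ℝ) :
    Matrix.partitionFn β (dWaveSourceTorus L U μ (-h)) = Matrix.partitionFn β (dWaveSourceTorus L U μ h) := by
  have key := partitionFn_hubbardTorusWith_sub_neg_smul_pairSource (L := L) β U μ (h : ℂ)
  unfold dWaveSourceTorus
  rw [Complex.ofReal_neg]
  convert key using 2

/-- **The interaction correction to the pair response of the pressure is `O(|U| h²)` at fixed temperature,
uniformly in the volume.** For `β ≥ 0`, `μ` there are `δ > 0`, `K ≥ 0` such that for all `L ≥ 3` and real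
`U, h` with `|U| ≤ δ`, `|h| ≤ δ`:
`|log Z_L(U,h) - log Z_L(U,0) - log Z_L(0,h) + log Z_L(0,0)| ≤ K L² |U| h²`
(`Z_L(U,h) = Tr e^{-β dWaveSourceTorus L U μ h}`). [cite: BenfattoGiulianiMastropietro2006, (2.77)] -/
theorem dWaveSourceTorus_log_partitionFn_mixed_increment_le_sq (hβ : 0 ≤ β) :
    ∃ δ : ℝ, 0 < δ ∧ ∃ K : ℝ, 0 ≤ K ∧ ∀ (L : ℕ) [NeZero L], 3 ≤ L →
      ∀ U h : ℝ, |U| ≤ δ → |h| ≤ δ →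
        |Real.log (Matrix.partitionFn β (dWaveSourceTorus L U μ h)).re -
            Real.log (Matrix.partitionFn β (dWaveSourceTorus L U μ 0)).re -
            Real.log (Matrix.partitionFn β (dWaveSourceTorus L 0 μ h)).re +
            Real.log (Matrix.partitionFn β (dWaveSourceTorus L 0 μ 0)).re| ≤
          K * (L : ℝ) ^ 2 * |U| * h ^ 2 := by
  classical
  obtain ⟨δ, hδ, ϱ, hϱ, hϱδ, A, hA, hmain⟩ := dWaveSourceTorus_partitionFn_eq_exp_doubleSeries β μ hβ
  refine ⟨δ, hδ, 81 * A * ϱ ^ 3, by positivity, ?_⟩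
  intro L _ hL U h hU hh
  obtain ⟨hC, hUh⟩ := hmain L hL
  haveI : Nonempty (Finset (Orb (FermionTorus 2 L))) := ⟨∅⟩
  -- abbreviations: the free operator, the connected coefficients, the restricted coefficients
  set K0 := shibaOneBody (dwsHopping L) (dwsPairing L 0) μ ((0 : ℝ) : ℂ) with hK0
  have hK0h : K0.IsHermitian := by
    refine isHermitian_shibaOneBody (fun x y => ?_) _ μ 0
    simp only [dwsHopping, apply_ite star, star_neg, star_one, star_zero, (fermionTorusGraph 2 L).adj_comm x y]
  set c : ℝ → ℝ → ℕ → ℂ := fun U' h' j => if j = 0 then (0 : ℂ) else orderedIntegral j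
    (wordUrsellIntegrand β K0 (dwsOp L) (dwsOm L) (dwsWeight L U' h') j) 1 with hc
  set Cf : ℕ → ℕ → ℂ := fun j m => orderedIntegral j (fun u : Fin j → ℝ => (-(β : ℂ)) ^ j *
      ∑ g ∈ univ.filter (fun g : Fin j → DwsType × FermionTorus 2 L =>
          (univ.filter fun i => Sum.isRight (g i).1).card = m),
        (∏ i, dwsWeight L 1 1 (g i)) *
          ursellOf (FermionicTree.moment (wordCluster 2 j)
            (wordPropMatrix β K0 (dwsOp L) (dwsOm L) g (fun i => ((u i : ℝ) : ℂ) * -(β : ℂ)))) univ) 1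
    with hCf
  set B : ℝ := (L : ℝ) ^ 2 * A with hB
  have hB0 : 0 ≤ B := by positivity
  have hCfb : ∀ j m : ℕ, 1 ≤ j → ‖Cf j m‖ ≤ B * ϱ ^ j := fun j m hj => hC j m hj
  have h0δ : |(0 : ℝ)| ≤ δ := by rw [abs_zero]; exact hδ.le
  have hgeo : Summable fun j : ℕ => (2 / 3 : ℝ) ^ j :=
    summable_geometric_of_lt_one (by norm_num) (by norm_num)
  have htwo : ∑' j : ℕ, (2 / 3 : ℝ) ^ j = 3 := by
    rw [tsum_geometric_of_lt_one (by norm_num) (by norm_num)]; norm_num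
  -- the data at the corners: representation, summability, the real logarithm
  have corner : ∀ U' h' : ℝ, |U'| ≤ δ → |h'| ≤ δ →
      (∀ j : ℕ, 1 ≤ j → c U' h' j = ∑ m ∈ Finset.range (j + 1),
        Cf j m * (U' : ℂ) ^ (j - m) * (h' : ℂ) ^ m) ∧
      (Summable fun j : ℕ => ‖c U' h' j‖) ∧
      Real.log (Matrix.partitionFn β (dWaveSourceTorus L U' μ h')).re =
        β * (μ * (L : ℝ) ^ 2) + Real.log (Matrix.partitionFn β (dGamma K0)).re + (∑' j : ℕ, c U' h' j).re := by
    intro U' h' hU' hh'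
    obtain ⟨hrep, hcj, hZ⟩ := hUh U' h' hU' hh'
    have hrep' : ∀ j : ℕ, 1 ≤ j → c U' h' j = ∑ m ∈ Finset.range (j + 1),
        Cf j m * (U' : ℂ) ^ (j - m) * (h' : ℂ) ^ m := by
      intro j hj
      simp only [hc, if_neg (Nat.one_le_iff_ne_zero.mp hj)]
      exact hrep j
    have hcb : ∀ j : ℕ, 1 ≤ j → ‖c U' h' j‖ ≤ B * (2 / 3) ^ j := by
      intro j hj
      simp only [hc, if_neg (Nat.one_le_iff_ne_zero.mp hj), hB]
      calc _ ≤ (L : ℝ) ^ 2 * A * ((j : ℝ) + 1) * (1 / 3) ^ j := hcj j hj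
        _ = (L : ℝ) ^ 2 * A * (((j : ℝ) + 1) * (1 / 3) ^ j) := by ring
        _ ≤ (L : ℝ) ^ 2 * A * (2 / 3) ^ j :=
            mul_le_mul_of_nonneg_left (succ_mul_third_pow_le j) (by positivity)
    have hsum : Summable fun j : ℕ => ‖c U' h' j‖ := by
      refine Summable.of_nonneg_of_le (fun j => norm_nonneg _) (fun j => ?_) (hgeo.mul_left B)
      by_cases hj0 : j = 0
      · subst hj0; simp only [hc, if_true, norm_zero]; positivity
      · exact hcb j (Nat.one_le_iff_ne_zero.mpr hj0)
    refine ⟨hrep', hsum, ?_⟩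
    have hZpos : 0 < Matrix.partitionFn β (dWaveSourceTorus L U' μ h') :=
      Matrix.partitionFn_pos β (dWaveSourceTorus_isHermitian L (isHermitian_hamiltonianWith (fermionTorusGraph 2 L) 1 U' μ) h')
    have hZ0pos : 0 < Matrix.partitionFn β (dGamma K0) := Matrix.partitionFn_pos β (isHermitian_dGamma hK0h)
    have hexp : (0 : ℂ) < (Real.exp (β * (μ * (L : ℝ) ^ 2)) : ℂ) := by exact_mod_cast Real.exp_pos _
    have hcpos : 0 < (Real.exp (β * (μ * (L : ℝ) ^ 2)) : ℂ) * Matrix.partitionFn β (dGamma K0) :=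
      mul_pos hexp hZ0pos
    have key := log_re_eq_of_eq_mul_exp hZpos hcpos hZ
    rw [key, Complex.re_ofReal_mul, Real.log_mul (Real.exp_pos _).ne' (Complex.pos_iff.mp hZ0pos).1.ne',
      Real.log_exp]
  -- the `h`-linear coefficient `S(U') = Σ_{j≥1} C_{j,1} U'^{j-1}` and its vanishing real part
  set s : ℝ → ℕ → ℂ := fun U' j => if j = 0 then 0 else Cf j 1 * (U' : ℂ) ^ (j - 1) with hs
  have hs_le : ∀ U' : ℝ, |U'| ≤ δ → ∀ j : ℕ, ‖s U' j‖ ≤ 3 * B * ϱ * (1 / 3) ^ j := by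
    intro U' hU' j
    by_cases hj0 : j = 0
    · subst hj0; simp only [hs, if_true, norm_zero]; positivity
    · have hj : 1 ≤ j := Nat.one_le_iff_ne_zero.mpr hj0
      simp only [hs, if_neg hj0, norm_mul, norm_pow, Complex.norm_real, Real.norm_eq_abs]
      have e1 : ϱ ^ j = ϱ * ϱ ^ (j - 1) := by rw [← pow_succ']; congr 1; omega
      have e2 : (1 / 3 : ℝ) ^ (j - 1) = 3 * (1 / 3) ^ j := by
        have : j = (j - 1) + 1 := by omega
        conv_rhs => rw [this, pow_succ]
        ring
      calc ‖Cf j 1‖ * |U'| ^ (j - 1) ≤ B * ϱ ^ j * δ ^ (j - 1) :=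
            mul_le_mul (hCfb j 1 hj) (pow_le_pow_left₀ (abs_nonneg _) hU' _) (by positivity) (by positivity)
        _ = B * ϱ * (ϱ * δ) ^ (j - 1) := by rw [e1, mul_pow]; ring
        _ ≤ B * ϱ * (1 / 3) ^ (j - 1) :=
            mul_le_mul_of_nonneg_left (pow_le_pow_left₀ (by positivity) hϱδ _) (by positivity)
        _ = 3 * B * ϱ * (1 / 3) ^ j := by rw [e2]; ring
  have hgeo3 : Summable fun j : ℕ => (1 / 3 : ℝ) ^ j :=
    summable_geometric_of_lt_one (by norm_num) (by norm_num)
  have hs_sum : ∀ U' : ℝ, |U'| ≤ δ → Summable (s U') := fun U' hU' =>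
    Summable.of_norm (Summable.of_nonneg_of_le (fun j => norm_nonneg _) (hs_le U' hU') (hgeo3.mul_left _))
  have hS_re : ∀ U' : ℝ, |U'| ≤ δ → (∑' j : ℕ, s U' j).re = 0 := by
    intro U' hU'
    refine eq_zero_of_abs_le_mul_sq hδ (by positivity : (0 : ℝ) ≤ 81 * B * ϱ ^ 3) fun t ht htδ => ?_
    have htabs : |t| ≤ δ := by rw [abs_of_pos ht]; exact htδ
    have hntabs : |(-t)| ≤ δ := by rw [abs_neg]; exact htabs
    obtain ⟨hrep_p, hsum_p, hlog_p⟩ := corner U' t hU' htabs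
    obtain ⟨hrep_n, hsum_n, hlog_n⟩ := corner U' (-t) hU' hntabs
    -- evenness: the two logarithms agree
    have heven : (∑' j : ℕ, c U' t j).re = (∑' j : ℕ, c U' (-t) j).re := by
      have := hlog_n
      rw [partitionFn_dWaveSourceTorus_neg_source β μ U' t, hlog_p] at this
      linarith
    -- the remainders beyond the linear term
    set r : ℕ → ℂ := fun j => c U' t j - c U' (-t) j - 2 * (t : ℂ) * s U' j with hr
    have hr_le : ∀ j : ℕ, ‖r j‖ ≤ 54 * B * ϱ ^ 3 * |t| ^ 3 * (2 / 3) ^ j := by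
      intro j
      by_cases hj0 : j = 0
      · subst hj0; simp only [hr, hc, hs, if_true, sub_self, mul_zero, norm_zero]; positivity
      · have hj : 1 ≤ j := Nat.one_le_iff_ne_zero.mpr hj0
        have hrj : r j = (∑ m ∈ Finset.range (j + 1), Cf j m * (U' : ℂ) ^ (j - m) * (t : ℂ) ^ m) -
            (∑ m ∈ Finset.range (j + 1), Cf j m * (U' : ℂ) ^ (j - m) * (((-t : ℝ)) : ℂ) ^ m) -
            2 * Cf j 1 * (U' : ℂ) ^ (j - 1) * (t : ℂ) := by
          simp only [hr, hs, if_neg hj0, hrep_p j hj, hrep_n j hj]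
          ring
        rw [hrj]
        calc _ ≤ 54 * B * ϱ ^ 3 * (((j : ℝ) + 1) * (1 / 3) ^ j) * |t| ^ 3 :=
              norm_odd_part_sub_linear_le hB0 hϱ.le hδ hϱδ hCfb hU' htabs hj
          _ ≤ 54 * B * ϱ ^ 3 * (2 / 3) ^ j * |t| ^ 3 := by
              have := succ_mul_third_pow_le j
              gcongr
          _ = 54 * B * ϱ ^ 3 * |t| ^ 3 * (2 / 3) ^ j := by ring
    have hr_sum : Summable fun j : ℕ => ‖r j‖ :=
      Summable.of_nonneg_of_le (fun j => norm_nonneg _) hr_le (hgeo.mul_left _)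
    -- `Σ (c⁺ - c⁻) = 2t·S + Σ r`
    have hsplit : (∑' j : ℕ, c U' t j) - (∑' j : ℕ, c U' (-t) j) =
        2 * (t : ℂ) * (∑' j : ℕ, s U' j) + ∑' j : ℕ, r j := by
      rw [← (Summable.of_norm hsum_p).tsum_sub (Summable.of_norm hsum_n), ← tsum_mul_left,
        ← ((hs_sum U' hU').mul_left _).tsum_add (Summable.of_norm hr_sum)]
      refine tsum_congr fun j => ?_
      simp only [hr]
      ring
    have hre : (2 * (t : ℂ) * (∑' j : ℕ, s U' j) + ∑' j : ℕ, r j).re = 0 := by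
      rw [← hsplit, Complex.sub_re, heven, sub_self]
    have hre' : 2 * t * (∑' j : ℕ, s U' j).re = -(∑' j : ℕ, r j).re := by
      rw [Complex.add_re] at hre
      have : (2 * (t : ℂ) * ∑' j : ℕ, s U' j).re = 2 * t * (∑' j : ℕ, s U' j).re := by
        rw [show (2 : ℂ) * (t : ℂ) = ((2 * t : ℝ) : ℂ) by push_cast; ring, Complex.re_ofReal_mul]
      linarith
    have hbound : |2 * t * (∑' j : ℕ, s U' j).re| ≤ 162 * B * ϱ ^ 3 * |t| ^ 3 := by
      rw [hre', abs_neg]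
      calc |(∑' j : ℕ, r j).re| ≤ ‖∑' j : ℕ, r j‖ := Complex.abs_re_le_norm _
        _ ≤ ∑' j : ℕ, ‖r j‖ := norm_tsum_le_tsum_norm hr_sum
        _ ≤ ∑' j : ℕ, 54 * B * ϱ ^ 3 * |t| ^ 3 * (2 / 3) ^ j :=
            Summable.tsum_le_tsum hr_le hr_sum (hgeo.mul_left _)
        _ = 54 * B * ϱ ^ 3 * |t| ^ 3 * 3 := by rw [tsum_mul_left, htwo]
        _ = 162 * B * ϱ ^ 3 * |t| ^ 3 := by ring
    rw [abs_mul, abs_mul, abs_of_pos (by norm_num : (0 : ℝ) < 2), abs_of_pos ht] at hbound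
    have ht2 : 0 < 2 * t := by positivity
    refine le_of_mul_le_mul_left ?_ ht2
    calc 2 * t * |(∑' j : ℕ, s U' j).re| ≤ 162 * B * ϱ ^ 3 * t ^ 3 := hbound
      _ = 2 * t * (81 * B * ϱ ^ 3 * t ^ 2) := by ring
  -- at `U' = 0`: `S(0) = C_{1,1}`, so `Re C_{1,1} = 0`
  have hS0 : (∑' j : ℕ, s 0 j) = Cf 1 1 := by
    rw [tsum_eq_single 1]
    · simp [hs]
    · intro j hj1
      by_cases hj0 : j = 0
      · subst hj0; simp [hs]
      · have : j - 1 ≠ 0 := by omega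
        simp only [hs, if_neg hj0, Complex.ofReal_zero, zero_pow this, mul_zero]
  have hC11 : (Cf 1 1).re = 0 := by rw [← hS0]; exact hS_re 0 h0δ
  -- the mixed increment
  obtain ⟨hrepUh, hsumUh, hlogUh⟩ := corner U h hU hh
  obtain ⟨hrepU0, hsumU0, hlogU0⟩ := corner U 0 hU h0δ
  obtain ⟨hrep0h, hsum0h, hlog0h⟩ := corner 0 h h0δ hh
  obtain ⟨hrep00, hsum00, hlog00⟩ := corner 0 0 h0δ h0δ
  set mx : ℕ → ℂ := fun j => c U h j - c U 0 j - c 0 h j + c 0 0 j with hmx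
  -- the linear-in-`h` part `ℓ_j = [2 ≤ j] C_{j,1} U^{j-1} h` and the remainder `q_j`
  set lin : ℕ → ℂ := fun j => if 2 ≤ j then Cf j 1 * (U : ℂ) ^ (j - 1) * (h : ℂ) else 0 with hlin
  set q : ℕ → ℂ := fun j => mx j - lin j with hq
  have hq_le : ∀ j : ℕ, ‖q j‖ ≤ 27 * B * ϱ ^ 3 * |U| * h ^ 2 * (2 / 3) ^ j := by
    intro j
    by_cases hj0 : j = 0
    · subst hj0
      simp only [hq, hmx, hlin, hc, if_true, sub_self, add_zero, show ¬ (2 ≤ 0) by omega, if_false,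
        norm_zero]
      positivity
    · have hj : 1 ≤ j := Nat.one_le_iff_ne_zero.mpr hj0
      have hqj : q j = (∑ m ∈ Finset.range (j + 1), Cf j m *
          ((U : ℂ) ^ (j - m) * (h : ℂ) ^ m - (U : ℂ) ^ (j - m) * (0 : ℂ) ^ m -
            (0 : ℂ) ^ (j - m) * (h : ℂ) ^ m + (0 : ℂ) ^ (j - m) * (0 : ℂ) ^ m)) - lin j := by
        simp only [hq, hmx, hrepUh j hj, hrepU0 j hj, hrep0h j hj, hrep00 j hj, Complex.ofReal_zero]
        congr 1
        rw [← Finset.sum_sub_distrib, ← Finset.sum_sub_distrib, ← Finset.sum_add_distrib]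
        refine Finset.sum_congr rfl fun m _ => ?_
        ring
      rw [hqj]
      calc _ ≤ 27 * B * ϱ ^ 3 * (((j : ℝ) + 1) * (1 / 3) ^ j) * |U| * h ^ 2 :=
            norm_mixed_part_sub_linear_le hB0 hϱ.le hδ hϱδ hCfb hU hh hj
        _ ≤ 27 * B * ϱ ^ 3 * (2 / 3) ^ j * |U| * h ^ 2 := by
            have := succ_mul_third_pow_le j
            gcongr
        _ = 27 * B * ϱ ^ 3 * |U| * h ^ 2 * (2 / 3) ^ j := by ring
  have hq_sum : Summable fun j : ℕ => ‖q j‖ :=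
    Summable.of_nonneg_of_le (fun j => norm_nonneg _) hq_le (hgeo.mul_left _)
  -- `Σ lin = h · (S(U) - C_{1,1})`
  have hlin_sum : Summable lin := by
    refine Summable.of_norm (Summable.of_nonneg_of_le (fun j => norm_nonneg _) (fun j => ?_)
      ((hgeo3.mul_left (3 * B * ϱ)).mul_right |h|))
    by_cases h2 : 2 ≤ j
    · simp only [hlin, if_pos h2, norm_mul, Complex.norm_real, Real.norm_eq_abs]
      have := hs_le U hU j
      simp only [hs, if_neg (show j ≠ 0 by omega), norm_mul] at this
      exact mul_le_mul_of_nonneg_right this (abs_nonneg _)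
    · simp only [hlin, if_neg h2, norm_zero]; positivity
  have hlin_eq : (∑' j : ℕ, lin j) = (h : ℂ) * ((∑' j : ℕ, s U j) - Cf 1 1) := by
    have hsj : ∀ j : ℕ, s U j = (if 2 ≤ j then Cf j 1 * (U : ℂ) ^ (j - 1) else 0) +
        (if j = 1 then Cf 1 1 else 0) := by
      intro j
      by_cases hj0 : j = 0
      · subst hj0; simp [hs]
      · by_cases hj1 : j = 1
        · subst hj1; simp [hs]
        · simp only [hs, if_neg hj0, if_pos (show 2 ≤ j by omega), if_neg hj1, add_zero]
    have hsum2 : Summable fun j : ℕ => (if 2 ≤ j then Cf j 1 * (U : ℂ) ^ (j - 1) else 0) := by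
      have : (fun j : ℕ => (if 2 ≤ j then Cf j 1 * (U : ℂ) ^ (j - 1) else 0)) =
          fun j => s U j - (if j = 1 then Cf 1 1 else 0) := by
        funext j; rw [hsj j]; ring
      rw [this]
      exact (hs_sum U hU).sub (summable_of_ne_finset_zero (s := {1}) (by intro j hj; simp at hj; simp [hj]))
    have hS : (∑' j : ℕ, s U j) = (∑' j : ℕ, (if 2 ≤ j then Cf j 1 * (U : ℂ) ^ (j - 1) else 0)) + Cf 1 1 := by
      rw [tsum_congr hsj, hsum2.tsum_add (summable_of_ne_finset_zero (s := {1})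
        (by intro j hj; simp at hj; simp [hj])), tsum_ite_eq]
    have hlin' : ∀ j : ℕ, lin j = (h : ℂ) * (if 2 ≤ j then Cf j 1 * (U : ℂ) ^ (j - 1) else 0) := by
      intro j
      by_cases h2 : 2 ≤ j
      · simp only [hlin, if_pos h2]; ring
      · simp only [hlin, if_neg h2, mul_zero]
    rw [tsum_congr hlin', tsum_mul_left, hS]
    ring
  -- assembling
  have hmx_sum : Summable mx := by
    have : mx = fun j => q j + lin j := by funext j; simp only [hq]; ring
    rw [this]
    exact (Summable.of_norm hq_sum).add hlin_sum
  have htsum : (∑' j : ℕ, c U h j) - (∑' j : ℕ, c U 0 j) - (∑' j : ℕ, c 0 h j) + (∑' j : ℕ, c 0 0 j) =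
      ∑' j : ℕ, mx j := by
    rw [← (Summable.of_norm hsumUh).tsum_sub (Summable.of_norm hsumU0),
      ← ((Summable.of_norm hsumUh).sub (Summable.of_norm hsumU0)).tsum_sub (Summable.of_norm hsum0h),
      ← (((Summable.of_norm hsumUh).sub (Summable.of_norm hsumU0)).sub (Summable.of_norm hsum0h)).tsum_add
        (Summable.of_norm hsum00)]
  have hmx_split : (∑' j : ℕ, mx j) = (∑' j : ℕ, q j) + (h : ℂ) * ((∑' j : ℕ, s U j) - Cf 1 1) := by
    rw [← hlin_eq, ← (Summable.of_norm hq_sum).tsum_add hlin_sum]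
    refine tsum_congr fun j => ?_
    simp only [hq]
    ring
  have hreal : Real.log (Matrix.partitionFn β (dWaveSourceTorus L U μ h)).re -
      Real.log (Matrix.partitionFn β (dWaveSourceTorus L U μ 0)).re -
      Real.log (Matrix.partitionFn β (dWaveSourceTorus L 0 μ h)).re +
      Real.log (Matrix.partitionFn β (dWaveSourceTorus L 0 μ 0)).re = (∑' j : ℕ, q j).re := by
    rw [hlogUh, hlogU0, hlog0h, hlog00]
    have hlinre : ((h : ℂ) * ((∑' j : ℕ, s U j) - Cf 1 1)).re = 0 := by
      rw [Complex.re_ofReal_mul, Complex.sub_re, hS_re U hU, hC11, sub_self, mul_zero]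
    have this := congrArg Complex.re htsum
    rw [hmx_split] at this
    have hrhs : ((∑' j : ℕ, q j) + (h : ℂ) * ((∑' j : ℕ, s U j) - Cf 1 1)).re = (∑' j : ℕ, q j).re := by
      rw [Complex.add_re, hlinre, add_zero]
    rw [hrhs] at this
    simp only [Complex.sub_re, Complex.add_re] at this
    linarith
  rw [hreal]
  calc |(∑' j : ℕ, q j).re| ≤ ‖∑' j : ℕ, q j‖ := Complex.abs_re_le_norm _
    _ ≤ ∑' j : ℕ, ‖q j‖ := norm_tsum_le_tsum_norm hq_sum
    _ ≤ ∑' j : ℕ, 27 * B * ϱ ^ 3 * |U| * h ^ 2 * (2 / 3) ^ j :=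
        Summable.tsum_le_tsum hq_le hq_sum (hgeo.mul_left _)
    _ = 27 * B * ϱ ^ 3 * |U| * h ^ 2 * 3 := by rw [tsum_mul_left, htwo]
    _ = 81 * A * ϱ ^ 3 * (L : ℝ) ^ 2 * |U| * h ^ 2 := by rw [hB]; ring

end Pressure

end Literature.MathematicalPhysics.QuantumLattice
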